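import Summits.HodgeConjecture.CorCM.GaloisOcticStabiliserLemma
import Literature.NumberTheory.ComplexMultiplication.CMTypeLattice
import Mathlib.FieldTheory.Galois.Basic
import HarnessLib

/-!
# Automorphisms of an octic CM field acting on its embeddings: freeness, fibres over an imaginary quadratic
# subfield, and the stabiliser produced by a balanced CM type (toolkit for `OcticCMFieldAutomorphismsNondegenerate`)

COR-CM (cell `pub-hodgecm2`), binder seat b04 (gen 13), count-neutral claim GALOIS-OCTIC, part IIIa; sequel of part I
`CorCM/GaloisOcticStabiliserLemma` (`σ_a = φ ∘ a⁻¹`, complex conjugation `c ∈ Aut(K)`).  KERNEL ONLY: theorems, no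
definition, no named fact, no `sorry`; `HC_CM` is not used.  No normality of `K/ℚ` is assumed anywhere in this file.

§1 `Aut(K)` acts FREELY on `Hom(K, ℂ)` by `σ ↦ σ ∘ a⁻¹` (`embOf_injective`, `embOf_eq_self_iff`, `embOf_mul`),
   commuting with `Aut(ℂ)` (`smul_embOf`) and with complex conjugation (`conjugate_embOf`; `c` is central in
   `Aut(K)`, `complexConj_comm`); an automorphism fixing a subfield `k` preserves the fibres of restriction to `k`
   (`comp_algebraMap_embOf_of_mem`); a subfield with a complex place is moved by `c`
   (`complexConj_not_mem_fixingSubgroup'`); and — since a quadratic extension of `ℚ` is normal (Mathlib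
   `Algebra.IsQuadraticExtension.normal`, `AlgEquiv.restrictNormalHom`) with `|Aut(k/ℚ)| = 2` — an automorphism
   `t ∉ {1, c}` yields a NON-TRIVIAL automorphism fixing a given imaginary quadratic subfield `k` (`t` or `tc`:
   `exists_mem_fixingSubgroup_ne_one`).
§2 Over a quadratic subfield `k` with a complex place every embedding of `K` restricts to `τ` or `τ̄`
   (`comp_algebraMap_eq_or`); a CM type of an octic field has `4` elements; if it is balanced over `k` then each
   fibre `E_τ` meets `Φ` in exactly `2` of its `4` points (`ncard_fibre_eq_two`: `Φ = (E_τ ∩ Φ) ⊔ c(E_τ ∖ Φ)`).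
§3 THE STABILISER (free-action form of part I's lemma, NEW).  For `a` fixing `k`: if `a` maps `S = E_τ ∩ Φ` into
   `Φ` then `Φ·a = Φ` (`forall_mem_iff_embOf_mem_of_mapsTo`); if `a` maps `S` out of `Φ` then `Φ·(ca) = Φ`
   (`forall_mem_iff_embOf_not_mem_of_mapsTo`); and in the asymmetric case `p·t = q`, `q·t ∉ Φ` (`S = {p, q}`) the
   square `t²` maps `S` out of `Φ` — `t³ = 1` is excluded because the fourth point of `E_τ` would have nowhere to
   go under `t` (`sq_mapsTo_compl_of_asym`).
-/

noncomputable section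

open NumberField

namespace Summit.HodgeConjecture.CorCM.GaloisOctic

open Literature.NumberTheory.ComplexMultiplication
open Literature.AlgebraicGeometry.Motives (CMType)
open Literature.AlgebraicGeometry.Pohlmann1968

open scoped Classical

/-! ## §1 Automorphisms act freely on the embeddings, commute with conjugation, preserve quadratic subfields -/

section Action

variable {K : Type} [Field K] [NumberField K]

/-- `a ↦ σ_a = φ ∘ a⁻¹` is injective for EVERY number field (no normality): an automorphism is determined by its
composite with one complex embedding. [folklore] -/
theorem embOf_injective (φ : K →+* ℂ) : Function.Injective (embOf φ) := by
  intro a b h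
  have h' : a.symm = b.symm := AlgEquiv.ext fun x => φ.injective (by
    have := RingHom.congr_fun h x
    rwa [embOf_apply, embOf_apply] at this)
  simpa using congrArg AlgEquiv.symm h'

/-- `σ_1 = φ`. [folklore] -/
theorem embOf_one (φ : K →+* ℂ) : embOf φ 1 = φ := RingHom.ext fun _ => rfl

/-- `φ ∘ (ab)⁻¹ = (φ ∘ b⁻¹) ∘ a⁻¹`: `embOf` is a (left) action of `Aut(K)` on `Hom(K, ℂ)`. [folklore] -/
theorem embOf_mul (φ : K →+* ℂ) (a b : K ≃ₐ[ℚ] K) : embOf φ (a * b) = embOf (embOf φ b) a := rfl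

/-- **Freeness**: `σ_a = φ` only for `a = 1`. [folklore] -/
theorem embOf_eq_self_iff (φ : K →+* ℂ) (a : K ≃ₐ[ℚ] K) : embOf φ a = φ ↔ a = 1 := by
  constructor
  · intro h
    exact embOf_injective φ (by rw [h, embOf_one])
  · rintro rfl; exact embOf_one φ

/-- `Aut(ℂ)` (acting by post-composition) commutes with the `Aut(K)`-action by pre-composition. [folklore] -/
theorem smul_embOf (γ : ℂ ≃+* ℂ) (φ : K →+* ℂ) (a : K ≃ₐ[ℚ] K) : γ • embOf φ a = embOf (γ • φ) a := by
  rw [ringEquiv_smul_def, ringEquiv_smul_def]; rfl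

/-- Complex conjugation of embeddings commutes with the `Aut(K)`-action. [folklore] -/
theorem conjugate_embOf (φ : K →+* ℂ) (a : K ≃ₐ[ℚ] K) :
    ComplexEmbedding.conjugate (embOf φ a) = embOf (ComplexEmbedding.conjugate φ) a :=
  RingHom.ext fun _ => rfl

/-- Restriction to a subfield commutes with complex conjugation. [folklore] -/
theorem conjugate_comp_algebraMap (k : IntermediateField ℚ K) (φ : K →+* ℂ) :
    (ComplexEmbedding.conjugate φ).comp (algebraMap k K) = ComplexEmbedding.conjugate (φ.comp (algebraMap k K)) :=
  RingHom.ext fun _ => rfl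

/-- An automorphism fixing the subfield `k` preserves the fibres of restriction to `k`. [folklore] -/
theorem comp_algebraMap_embOf_of_mem {k : IntermediateField ℚ K} {h : K ≃ₐ[ℚ] K} (hh : h ∈ k.fixingSubgroup)
    (φ : K →+* ℂ) : (embOf φ h).comp (algebraMap k K) = φ.comp (algebraMap k K) := by
  rw [← inv_mem_iff, IntermediateField.mem_fixingSubgroup_iff] at hh
  refine RingHom.ext fun a => ?_
  simp only [RingHom.coe_comp, Function.comp_apply, embOf_apply]
  exact congrArg φ (hh a a.2)

variable [IsCMField K]

/-- `σ_c = φ̄` for `c` = complex conjugation of the CM field (Mathlib `IsCMField.complexEmbedding_complexConj`, for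
every embedding, no normality). [cite: Shimura1998, §18.2 Lemma (i)] -/
theorem embOf_complexConj_eq_conjugate (φ : K →+* ℂ) :
    embOf φ ((IsCMField.complexConj K).restrictScalars ℚ) = ComplexEmbedding.conjugate φ := by
  have h := embOf_mul_complexConj φ 1
  rwa [one_mul, embOf_one] at h

/-- **Complex conjugation is central in `Aut(K)`** for every CM field (no normality: `σ_{ca} = σ_{ac} = σ̄_a` and
freeness). [cite: Shimura1998, §18.2 Lemma (i)] -/
theorem complexConj_comm (a : K ≃ₐ[ℚ] K) :
    (IsCMField.complexConj K).restrictScalars ℚ * a = a * (IsCMField.complexConj K).restrictScalars ℚ := by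
  obtain ⟨φ₀⟩ := (inferInstance : Nonempty (K →+* ℂ))
  apply embOf_injective φ₀
  rw [embOf_complexConj_mul, embOf_mul_complexConj]

/-- A subfield with a complex place is moved by complex conjugation (no normality): if `c` fixed `k`, every
embedding `τ₀ = φ|_k` of `k` would be real. [folklore] -/
theorem complexConj_not_mem_fixingSubgroup' (k : IntermediateField ℚ K) (τ₀ : k →+* ℂ)
    (hτ₀ : ComplexEmbedding.conjugate τ₀ ≠ τ₀) :
    (IsCMField.complexConj K).restrictScalars ℚ ∉ k.fixingSubgroup := by
  -- extend `τ₀` to `K` by the transitivity of `Aut(ℂ)` on `Hom(k, ℂ)`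
  obtain ⟨φ₁⟩ := (inferInstance : Nonempty (K →+* ℂ))
  haveI := isPretransitive_ringEquiv_complex (K := k)
  obtain ⟨γ, hγ⟩ := MulAction.exists_smul_eq (ℂ ≃+* ℂ) (φ₁.comp (algebraMap k K)) τ₀
  have hφ : (γ.toRingHom.comp φ₁).comp (algebraMap k K) = τ₀ := by
    rw [RingHom.comp_assoc, ← ringEquiv_smul_def, hγ]
  intro hc
  apply hτ₀
  rw [← hφ, ← conjugate_comp_algebraMap, ← embOf_complexConj_eq_conjugate, comp_algebraMap_embOf_of_mem hc]

/-- **An automorphism other than `1` and `c` yields a non-trivial automorphism fixing the imaginary quadratic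
subfield `k`**: automorphisms preserve `k` (a quadratic extension of `ℚ` is normal), `Aut(k/ℚ)` has two elements,
and `c|_k ≠ 1`; so `t|_k = 1` (take `t`) or `t|_k = c|_k` (take `t c`). [folklore] -/
theorem exists_mem_fixingSubgroup_ne_one (k : IntermediateField ℚ K) (hk2 : Module.finrank ℚ k = 2)
    (τ₀ : k →+* ℂ) (hτ₀ : ComplexEmbedding.conjugate τ₀ ≠ τ₀) (t : K ≃ₐ[ℚ] K) (ht1 : t ≠ 1)
    (htc : t ≠ (IsCMField.complexConj K).restrictScalars ℚ) :
    ∃ h : K ≃ₐ[ℚ] K, h ∈ k.fixingSubgroup ∧ h ≠ 1 := by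
  set c : K ≃ₐ[ℚ] K := (IsCMField.complexConj K).restrictScalars ℚ with hc_def
  haveI : Algebra.IsQuadraticExtension ℚ k := { finrank_eq_two' := hk2 }
  -- restriction to the normal subextension `k`
  let ρ : (K ≃ₐ[ℚ] K) →* (k ≃ₐ[ℚ] k) := AlgEquiv.restrictNormalHom k
  have hρ : ∀ a : K ≃ₐ[ℚ] K, a ∈ k.fixingSubgroup ↔ ρ a = 1 := by
    intro a
    rw [IntermediateField.mem_fixingSubgroup_iff]
    constructor
    · intro h
      refine AlgEquiv.ext fun x => ?_
      apply (algebraMap k K).injective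
      rw [show ρ a = a.restrictNormal k from rfl, AlgEquiv.restrictNormal_commutes, AlgEquiv.one_apply]
      exact h x x.2
    · intro h x hx
      have := AlgEquiv.restrictNormal_commutes a k ⟨x, hx⟩
      rw [show a.restrictNormal k = ρ a from rfl, h, AlgEquiv.one_apply] at this
      exact this.symm
  -- `Aut(k/ℚ)` has exactly two elements, so non-identity elements coincide and square to `1`
  have hcard : Nat.card (k ≃ₐ[ℚ] k) = 2 := by rw [IsGalois.card_aut_eq_finrank, hk2]
  have huniq : ∀ z w : k ≃ₐ[ℚ] k, z ≠ 1 → w ≠ 1 → z = w := fun z w hz hw =>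
    ((Nat.card_eq_two_iff' (1 : k ≃ₐ[ℚ] k)).1 hcard).unique hz hw
  haveI : Finite (k ≃ₐ[ℚ] k) := Nat.finite_of_card_ne_zero (by rw [hcard]; norm_num)
  have hsq : ∀ z : k ≃ₐ[ℚ] k, z * z = 1 := fun z => by
    have h := pow_card_eq_one' (x := z)
    rwa [hcard, pow_two] at h
  have hρc : ρ c ≠ 1 := fun h => complexConj_not_mem_fixingSubgroup' k τ₀ hτ₀ ((hρ c).2 h)
  by_cases ht : ρ t = 1
  · exact ⟨t, (hρ t).2 ht, ht1⟩
  · refine ⟨t * c, (hρ _).2 ?_, fun h => htc ?_⟩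
    · rw [map_mul, huniq (ρ t) (ρ c) ht hρc, hsq]
    · -- `t c = 1` forces `t = c⁻¹ = c`
      rw [eq_inv_of_mul_eq_one_left h, inv_eq_iff_mul_eq_one, complexConj_mul_self]

end Action

/-! ## §2 Fibres over an imaginary quadratic subfield: counting, and the stabiliser from a balanced type -/

section Fibres

variable {K : Type} [Field K] [NumberField K]

/-- `σ_{a⁻¹}(σ_a(ψ)) = ψ`. [folklore] -/
theorem embOf_embOf_inv (ψ : K →+* ℂ) (a : K ≃ₐ[ℚ] K) : embOf (embOf ψ a) a⁻¹ = ψ := by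
  rw [← embOf_mul, inv_mul_cancel, embOf_one]

/-- Right cancellation: `ψ ∘ a⁻¹ = ψ′ ∘ a⁻¹ → ψ = ψ′`. [folklore] -/
theorem embOf_left_injective (a : K ≃ₐ[ℚ] K) : Function.Injective fun ψ : K →+* ℂ => embOf ψ a := by
  intro ψ ψ' h
  have := congrArg (fun χ => embOf χ a⁻¹) h
  simpa only [embOf_embOf_inv] using this

/-- **Every embedding of `K` restricts on a quadratic subfield `k` with a complex place to `τ` or to `τ̄`**
(`Hom(k, ℂ)` has `[k:ℚ] = 2` elements). [folklore] -/
theorem comp_algebraMap_eq_or (k : IntermediateField ℚ K) (hk2 : Module.finrank ℚ k = 2) (τ : k →+* ℂ)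
    (hτ : ComplexEmbedding.conjugate τ ≠ τ) (ψ : K →+* ℂ) :
    ψ.comp (algebraMap k K) = τ ∨ ψ.comp (algebraMap k K) = ComplexEmbedding.conjugate τ := by
  have hcard : Fintype.card (k →+* ℂ) = 2 := by rw [NumberField.Embeddings.card, hk2]
  by_contra h
  push Not at h
  have hle : ({ψ.comp (algebraMap k K), τ, ComplexEmbedding.conjugate τ} : Finset (k →+* ℂ)).card ≤ 2 :=
    hcard ▸ Finset.card_le_univ _
  rw [Finset.card_insert_of_notMem, Finset.card_pair hτ.symm] at hle
  · omega
  · simp only [Finset.mem_insert, Finset.mem_singleton, not_or]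
    exact h

/-- If `τ₀` is a non-real embedding of the quadratic field `k`, then so is EVERY embedding `τ` of `k`
(`τ ∈ {τ₀, τ̄₀}`). [folklore] -/
theorem conjugate_ne_of_finrank_eq_two (k : IntermediateField ℚ K) (hk2 : Module.finrank ℚ k = 2) (τ₀ : k →+* ℂ)
    (hτ₀ : ComplexEmbedding.conjugate τ₀ ≠ τ₀) (ψ : K →+* ℂ) :
    ComplexEmbedding.conjugate (ψ.comp (algebraMap k K)) ≠ ψ.comp (algebraMap k K) := by
  rcases comp_algebraMap_eq_or k hk2 τ₀ hτ₀ ψ with h | h <;> rw [h]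
  · exact hτ₀
  · rw [ComplexEmbedding.involutive_conjugate (↥k) τ₀]
    exact fun h' => hτ₀ h'.symm

/-- A CM type of an octic CM field has `4` elements (`2·|Φ| = [K:ℚ]`). [cite: Shimura1998, §6.1 Thm. 2 (p. 41)] -/
theorem ncard_cmType_eq_four (hK : Module.finrank ℚ K = 8) (Φ : CMType K) : Φ.1.ncard = 4 := by
  have h := CMTypeLattice.two_mul_card_eq_finrank Φ
  rw [hK, Fintype.card_eq_nat_card, Nat.card_coe_set_eq] at h
  omega

/-- **The fibre of a CM type over an embedding of an imaginary quadratic subfield has exactly two elements inside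
and two outside the type, when the type is balanced over that subfield** (`|Φ| = 4`, `Φ = S ⊔ c(S′)`).
[cite: Gordon1999HodgeAVSurvey, 5.13 (ii)] -/
theorem ncard_fibre_eq_two (hK : Module.finrank ℚ K = 8) (Φ : CMType K) (k : IntermediateField ℚ K)
    (hk2 : Module.finrank ℚ k = 2) (τ : k →+* ℂ) (hτ : ComplexEmbedding.conjugate τ ≠ τ)
    (hbal : {φ : K →+* ℂ | φ.comp (algebraMap k K) = τ ∧ φ ∈ Φ.1}.ncard =
      {φ : K →+* ℂ | φ.comp (algebraMap k K) = τ ∧ φ ∉ Φ.1}.ncard) :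
    {φ : K →+* ℂ | φ.comp (algebraMap k K) = τ ∧ φ ∈ Φ.1}.ncard = 2 ∧
      {φ : K →+* ℂ | φ.comp (algebraMap k K) = τ ∧ φ ∉ Φ.1}.ncard = 2 := by
  set S := {φ : K →+* ℂ | φ.comp (algebraMap k K) = τ ∧ φ ∈ Φ.1} with hS
  set S' := {φ : K →+* ℂ | φ.comp (algebraMap k K) = τ ∧ φ ∉ Φ.1} with hS'
  -- `Φ = S ⊔ conj(S′)`
  have hΦ : Φ.1 = S ∪ ComplexEmbedding.conjugate '' S' := by
    ext φ
    constructor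
    · intro hφ
      rcases comp_algebraMap_eq_or k hk2 τ hτ φ with h | h
      · exact Or.inl ⟨h, hφ⟩
      · refine Or.inr ⟨ComplexEmbedding.conjugate φ, ⟨?_, ?_⟩, ComplexEmbedding.involutive_conjugate K φ⟩
        · rw [conjugate_comp_algebraMap, h, ComplexEmbedding.involutive_conjugate (↥k) τ]
        · exact (CMTypeOps.mem_iff_conjugate_notMem Φ φ).1 hφ
    · rintro (⟨-, hφ⟩ | ⟨ψ, ⟨-, hψ⟩, rfl⟩)
      · exact hφ
      · exact (CMTypeOps.conjugate_mem_iff_notMem Φ ψ).2 hψ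
  have hdisj : Disjoint S (ComplexEmbedding.conjugate '' S') := by
    rw [Set.disjoint_left]
    rintro φ ⟨hφ, -⟩ ⟨ψ, ⟨hψ, -⟩, rfl⟩
    apply hτ
    rw [← hψ, ← conjugate_comp_algebraMap, hφ]
    exact hψ.symm
  have hinj : Function.Injective (ComplexEmbedding.conjugate : (K →+* ℂ) → (K →+* ℂ)) :=
    (ComplexEmbedding.involutive_conjugate K).injective
  have h4 := ncard_cmType_eq_four hK Φ
  rw [hΦ, Set.ncard_union_eq hdisj (Set.toFinite _) (Set.toFinite _), Set.ncard_image_of_injective _ hinj,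
    ← hbal] at h4
  constructor <;> omega

end Fibres

/-! ## §3 The stabiliser: from a non-trivial automorphism fixing `k` to `Φ·a = Φ` or `Φ·(ca) = Φ` -/

section Stabiliser

variable {K : Type} [Field K] [NumberField K] {Φ : CMType K} {k : IntermediateField ℚ K} {τ : k →+* ℂ}

/-- **Case `S·a ⊆ S`.**  If an automorphism `a` fixing `k` maps the part `S = E_τ ∩ Φ` of the fibre `E_τ` into `Φ`,
then `ψ ∈ Φ ↔ ψ·a ∈ Φ` for EVERY embedding `ψ` (`a` permutes the finite set `S`; the other fibre `E_τ̄ = c(E_τ)`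
follows by the CM condition). [folklore] -/
theorem forall_mem_iff_embOf_mem_of_mapsTo (hk2 : Module.finrank ℚ k = 2)
    (hτ : ComplexEmbedding.conjugate τ ≠ τ) {a : K ≃ₐ[ℚ] K} (ha : a ∈ k.fixingSubgroup)
    (hA : ∀ ψ : K →+* ℂ, ψ.comp (algebraMap k K) = τ → ψ ∈ Φ.1 → embOf ψ a ∈ Φ.1) :
    ∀ ψ : K →+* ℂ, ψ ∈ Φ.1 ↔ embOf ψ a ∈ Φ.1 := by
  set S := {φ : K →+* ℂ | φ.comp (algebraMap k K) = τ ∧ φ ∈ Φ.1} with hS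
  have hmaps : Set.MapsTo (fun ψ : K →+* ℂ => embOf ψ a) S S := fun ψ hψ =>
    ⟨(comp_algebraMap_embOf_of_mem ha ψ).trans hψ.1, hA ψ hψ.1 hψ.2⟩
  have hbij : Set.BijOn (fun ψ : K →+* ℂ => embOf ψ a) S S :=
    ((Set.toFinite S).injOn_iff_bijOn_of_mapsTo hmaps).1 (embOf_left_injective a).injOn
  -- on the fibre `E_τ`
  have hE : ∀ ψ : K →+* ℂ, ψ.comp (algebraMap k K) = τ → (ψ ∈ Φ.1 ↔ embOf ψ a ∈ Φ.1) := by
    intro ψ hψ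
    refine ⟨hA ψ hψ, fun h => ?_⟩
    obtain ⟨ψ', hψ'S, hψ'⟩ := hbij.surjOn ⟨(comp_algebraMap_embOf_of_mem ha ψ).trans hψ, h⟩
    rw [← embOf_left_injective a hψ']
    exact hψ'S.2
  intro ψ
  rcases comp_algebraMap_eq_or k hk2 τ hτ ψ with hψ | hψ
  · exact hE ψ hψ
  · -- `ψ̄ ∈ E_τ`: `ψ ∈ Φ ↔ ψ̄ ∉ Φ ↔ ψ̄·a ∉ Φ ↔ (ψ·a)‾ ∉ Φ ↔ ψ·a ∈ Φ`
    have hψ' : (ComplexEmbedding.conjugate ψ).comp (algebraMap k K) = τ := by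
      rw [conjugate_comp_algebraMap, hψ, ComplexEmbedding.involutive_conjugate (↥k) τ]
    rw [CMTypeOps.mem_iff_conjugate_notMem Φ ψ, hE _ hψ', ← conjugate_embOf,
      CMTypeOps.conjugate_mem_iff_notMem, not_not]

/-- **Case `S·a ⊆ S′`.**  If an automorphism `a` fixing `k` maps `S = E_τ ∩ Φ` OUT of `Φ` and `|S| = |E_τ ∖ Φ|`,
then `ψ ∈ Φ ↔ ψ·a ∉ Φ ↔ ψ·(ca) ∈ Φ` for every embedding `ψ` (`S·a = S′`, `S′·a = S`). [folklore] -/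
theorem forall_mem_iff_embOf_not_mem_of_mapsTo [IsCMField K] (hk2 : Module.finrank ℚ k = 2)
    (hτ : ComplexEmbedding.conjugate τ ≠ τ) {a : K ≃ₐ[ℚ] K} (ha : a ∈ k.fixingSubgroup)
    (hcard : {φ : K →+* ℂ | φ.comp (algebraMap k K) = τ ∧ φ ∈ Φ.1}.ncard =
      {φ : K →+* ℂ | φ.comp (algebraMap k K) = τ ∧ φ ∉ Φ.1}.ncard)
    (hB : ∀ ψ : K →+* ℂ, ψ.comp (algebraMap k K) = τ → ψ ∈ Φ.1 → embOf ψ a ∉ Φ.1) :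
    ∀ ψ : K →+* ℂ, ψ ∈ Φ.1 ↔ embOf ψ ((IsCMField.complexConj K).restrictScalars ℚ * a) ∈ Φ.1 := by
  set S := {φ : K →+* ℂ | φ.comp (algebraMap k K) = τ ∧ φ ∈ Φ.1} with hS
  set S' := {φ : K →+* ℂ | φ.comp (algebraMap k K) = τ ∧ φ ∉ Φ.1} with hS'
  have hmaps : Set.MapsTo (fun ψ : K →+* ℂ => embOf ψ a) S S' := fun ψ hψ =>
    ⟨(comp_algebraMap_embOf_of_mem ha ψ).trans hψ.1, hB ψ hψ.1 hψ.2⟩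
  -- `S·a = S′` by counting
  have himage : (fun ψ : K →+* ℂ => embOf ψ a) '' S = S' :=
    Set.eq_of_subset_of_ncard_le hmaps.image_subset
      (by rw [Set.ncard_image_of_injective _ (embOf_left_injective a), hcard]) (Set.toFinite _)
  have hE : ∀ ψ : K →+* ℂ, ψ.comp (algebraMap k K) = τ → (ψ ∈ Φ.1 ↔ embOf ψ a ∉ Φ.1) := by
    intro ψ hψ
    refine ⟨hB ψ hψ, fun h => ?_⟩
    by_contra hψΦ
    -- `ψ ∈ S′ = S·a`, so `ψ·a ∈ S′·a`; but `ψ·a ∈ S′ = S·a` gives `ψ ∈ S`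
    have hmem : embOf ψ a ∈ S' := ⟨(comp_algebraMap_embOf_of_mem ha ψ).trans hψ, h⟩
    rw [← himage] at hmem
    obtain ⟨ψ', hψ'S, hψ'⟩ := hmem
    rw [← embOf_left_injective a hψ'] at hψΦ
    exact hψΦ hψ'S.2
  intro ψ
  rw [embOf_mul, embOf_complexConj_eq_conjugate, CMTypeOps.conjugate_mem_iff_notMem]
  rcases comp_algebraMap_eq_or k hk2 τ hτ ψ with hψ | hψ
  · exact hE ψ hψ
  · have hψ' : (ComplexEmbedding.conjugate ψ).comp (algebraMap k K) = τ := by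
      rw [conjugate_comp_algebraMap, hψ, ComplexEmbedding.involutive_conjugate (↥k) τ]
    rw [CMTypeOps.mem_iff_conjugate_notMem Φ ψ, hE _ hψ', not_not, ← conjugate_embOf,
      CMTypeOps.conjugate_mem_iff_notMem]

/-- **The combinatorial heart (asymmetric case).**  In the fibre `E_τ` let `S = E_τ ∩ Φ = {p, q}` and let
`S′ = E_τ ∖ Φ` have two elements; if `t` fixes `k`, `p·t = q` and `q·t ∉ Φ`, then `t² ≠ 1` and `t²` maps BOTH `p`
and `q` out of `Φ` — because `t³ = 1` would leave the fourth point of `E_τ` nowhere to go.  NEW (free-action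
form of the stabiliser lemma of part I). -/
theorem sq_mapsTo_compl_of_asym {p q : K →+* ℂ} (hp : p.comp (algebraMap k K) = τ) (hpΦ : p ∈ Φ.1) (hqΦ : q ∈ Φ.1)
    (hS : ∀ ψ : K →+* ℂ, ψ.comp (algebraMap k K) = τ → ψ ∈ Φ.1 → ψ = p ∨ ψ = q)
    (hS' : {φ : K →+* ℂ | φ.comp (algebraMap k K) = τ ∧ φ ∉ Φ.1}.ncard = 2)
    {t : K ≃ₐ[ℚ] K} (ht : t ∈ k.fixingSubgroup) (hpt : embOf p t = q) (hqt : embOf q t ∉ Φ.1) :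
    t * t ≠ 1 ∧ embOf p (t * t) ∉ Φ.1 ∧ embOf q (t * t) ∉ Φ.1 := by
  have hq : q.comp (algebraMap k K) = τ := by rw [← hpt, comp_algebraMap_embOf_of_mem ht, hp]
  have hfib : ∀ (ψ : K →+* ℂ) (b : K ≃ₐ[ℚ] K), b ∈ k.fixingSubgroup → ψ.comp (algebraMap k K) = τ →
      (embOf ψ b).comp (algebraMap k K) = τ := fun ψ b hb hψ => (comp_algebraMap_embOf_of_mem hb ψ).trans hψ
  have htt : t * t ∈ k.fixingSubgroup := mul_mem ht ht
  have hp2 : embOf p (t * t) ∉ Φ.1 := by rwa [embOf_mul, hpt]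
  have ht2 : t * t ≠ 1 := by
    intro h; apply hp2; rw [h, embOf_one]; exact hpΦ
  refine ⟨ht2, hp2, fun hq2 => ?_⟩
  -- `q·t² ∈ E_τ ∩ Φ = {p, q}`; `= q` would give `t² = 1`
  rcases hS _ (hfib q _ htt hq) hq2 with h | h
  swap
  · exact ht2 ((embOf_eq_self_iff q _).1 h)
  -- so `q·t² = p`, i.e. `p·t³ = p`, `t³ = 1`
  have ht3 : t * t * t = 1 := by
    rw [← embOf_eq_self_iff p, embOf_mul, hpt]; exact h
  -- the fourth point `r` of the fibre: `S′ = {q·t, r}`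
  obtain ⟨x, y, hxy, hS'xy⟩ := Set.ncard_eq_two.1 hS'
  have hqtS' : embOf q t ∈ ({x, y} : Set (K →+* ℂ)) := by rw [← hS'xy]; exact ⟨hfib q t ht hq, hqt⟩
  -- pick `r ∈ S′` with `r ≠ q·t`
  obtain ⟨r, hrS', hrne⟩ : ∃ r, r ∈ {φ : K →+* ℂ | φ.comp (algebraMap k K) = τ ∧ φ ∉ Φ.1} ∧ r ≠ embOf q t := by
    simp only [Set.mem_insert_iff, Set.mem_singleton_iff] at hqtS'
    rcases hqtS' with h' | h'
    · exact ⟨y, by rw [hS'xy]; exact Set.mem_insert_of_mem x rfl, fun e => hxy (h'.symm.trans e.symm)⟩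
    · exact ⟨x, by rw [hS'xy]; exact Set.mem_insert x {y}, fun e => hxy (e.trans h')⟩
  -- where does `r·t` go?
  have hrt : (embOf r t).comp (algebraMap k K) = τ := hfib r t ht hrS'.1
  by_cases hrtΦ : embOf r t ∈ Φ.1
  · rcases hS _ hrt hrtΦ with e | e
    · -- `r·t = p` ⟹ `r = p·t⁻¹ = p·t² = q·t`
      apply hrne
      have : r = embOf p t⁻¹ := by rw [← e, embOf_embOf_inv]
      rw [this, ← hpt, ← embOf_mul]
      congr 1
      -- `t⁻¹ = t * t` from `t³ = 1`
      exact (mul_eq_one_iff_eq_inv.mp ht3).symm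
    · -- `r·t = q = p·t` ⟹ `r = p ∈ Φ`
      rw [← hpt] at e
      exact hrS'.2 ((embOf_left_injective t e).symm ▸ hpΦ)
  · -- `r·t ∈ S′ = {q·t, r}`: `r·t = r` gives `t = 1`, `r·t = q·t` gives `r = q ∈ Φ`
    have hmem : embOf r t ∈ ({x, y} : Set (K →+* ℂ)) := by rw [← hS'xy]; exact ⟨hrt, hrtΦ⟩
    have hrS'xy : r ∈ ({x, y} : Set (K →+* ℂ)) := by rw [← hS'xy]; exact hrS'
    -- `{x, y} = {q·t, r}` as both are two-element sets containing these two distinct elements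
    have hrt_cases : embOf r t = embOf q t ∨ embOf r t = r := by
      simp only [Set.mem_insert_iff, Set.mem_singleton_iff] at hmem hrS'xy hqtS'
      rcases hmem with h1 | h1 <;> rcases hrS'xy with h2 | h2 <;> rcases hqtS' with h3 | h3
      all_goals first
        | exact Or.inr (h1.trans h2.symm)
        | exact Or.inl (h1.trans h3.symm)
        | exact absurd (h2.trans h3.symm) hrne
    rcases hrt_cases with e | e
    · exact hrS'.2 ((embOf_left_injective t e).symm ▸ hqΦ)
    · have ht1 : t = 1 := (embOf_eq_self_iff r t).1 e
      apply hqt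
      rw [ht1, embOf_one]; exact hqΦ

end Stabiliser

end Summit.HodgeConjecture.CorCM.GaloisOctic

end
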